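import Literature.AlgebraicGeometry.Motives.HodgeThetaSubalgebraUnitaryAnnihilatorIdealTop
import HarnessLib

/-!
# The `Θ`-subalgebra theorem beyond coprime multiplicities, II: the Levi data of an irreducible `𝔊 ∋ 1, Θ` at
# multiplicities `(2,4)` — matrix units `E₁, E₂, U, V` of `Q = C(P) ⊕ K`, level-one Levi irreducibility, graded parts
# (Ribet 1983 Thm. 3, Lie step; socket for the tensor-skeleton branch of the `(2,4)` dichotomy — classification-free)

Family `hodge`, layer `Literature/AlgebraicGeometry/Motives` (pure complex linear algebra; no geometry). Written for the cell
`pub-hodgeav-hg6` (req-37 (A) row 2 «base of HC ladder», TABLE X row 8-`(4,2)`, crux `UnitaryThetaCore.top_or_radical_two_four`;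
eng-5 lineage g5, brick V2a; honest framing of that cell: HC / HC_AV / HC_CM / H2 NOT proved — THIS file is unconditional linear
algebra and discharges no hypothesis of the cell's cover). UNCONDITIONAL; theorems only — no definition, no named fact (D-0026),
no `sorry`. DERIVE-FROM-R61 rule: the full-rank pair is hg6's `UnitaryThetaCore.exists_fullRank_pair_two` (U2b), the
Cayley–Hamilton idempotent, the Levi restriction algebra and its irreducibility, and the raising operator ONTO the small
eigenspace are the tree's `UnitaryTwoOdd.exists_idempotent_of_fullRank_pair`, `UnitaryTwoOdd.levi_irreducible`,
`UnitaryTwoOdd.exists_raise_onto` (`HodgeThetaSubalgebraUnitaryTwoOddCore`, cell `pub-hodge-ring2`, lit g83) — IMPORTED; the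
construction of the Levi algebra `𝔩 ⊆ End(Q)` inside the proof is COPIED from `UnitaryTwoOdd.eq_top` (credited here and at the
spot), because that file keeps it private to its induction.

THE PRINT. Ribet 1983 Thm. 3 / Gordon 1997 pp. 18–19 (the `Θ`-grading method); Moonen–Zarhin 1999 §2 (2.4)–(2.5); Tankeev 1996
(dimension 6). Goodman–Wallach §4.1.1 (gradings of `𝔤𝔩` by a semisimple element; here the pair of commuting idempotents
`E₁, E₂` refining `Θ`).

SETTING. `𝔊 ⊆ End(W)` closed under the commutator, irreducible, `1, Θ ∈ 𝔊`, `Θ² = 1`, `P = {Θ = 1}` of dimension `2`,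
`Q = {Θ = −1}` of dimension `4`.

WHAT IS PROVED — **`UnitaryFourTwo.exists_levi_data`**: there are `E₁, E₂, U, V, C ∈ 𝔊` with
* `E₁ + E₂ = π_Q = ½(1 − Θ)`, `E₁² = E₁`, `E₂² = E₂`, `E₁E₂ = E₂E₁ = 0`, `E₂Θ = ΘE₂`, `rank E₁ = rank E₂ = 2`
  (`E₂ = E` is the Cayley–Hamilton idempotent of a full-rank pair `(B, C)`, `range E₂ = K = Q ∩ ker CB`,
  `range E₁ = C(P)`);
* `C` lowering, injective on `P`, with values in `range E₁`;
* `U = E₁ U E₂` mapping `range E₂` ONTO `range E₁` and injective there; `V = E₂ V E₁` mapping `range E₁` onto `range E₂`,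
  injective there (lifts `ZE − EZ`, `EZ′ − Z′E` of the raising operators onto the two eigenspaces of the involution
  `1 − 2E|_Q` of the Levi algebra, `UnitaryTwoOdd.exists_raise_onto` twice);
* LEVEL-ONE LEVI IRREDUCIBILITY on `W`: a subspace of `Q` stable under every `Θ`-commuting element of `𝔊` is `0` or `Q`;
* GRADED PARTS: for `Θ`-commuting `X ∈ 𝔊`, `E₁XE₂ = ½([E,[E,X]] − [E,X])` and `E₂XE₁ = ½([E,[E,X]] + [E,X])` lie in `𝔊`,
  and `X − E₁XE₂ − E₂XE₁` commutes with `E₂`.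
SEQUEL (brick V2b): if `Q` has a proper non-zero subspace stable under the `P`-annihilator ideal, the `E₁`–`E₂` raising and
lowering parts of `𝔊` are the LINES `ℂU`, `ℂV` (a `2 × 2` lemma), `UV` is a non-zero multiple of `E₁`, and
`SymplecticThetaSix.skeleton_levi`-type structure follows; otherwise V1 (`UnitaryFourTwo.eq_top_of_annP_irreducible`) gives
`𝔊 = End(W)`.

## References
* [Ribet1983] K. A. Ribet, Amer. J. Math. 105 (1983), Thm. 3.
* [Gordon1997] B. B. Gordon, *A survey of the Hodge conjecture for abelian varieties*, §6 (proof of Thm. 6.3.3, pp. 18–19).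
* [MoonenZarhin1999LowDim] B. Moonen, Yu. Zarhin, Math. Ann. 315 (1999), §2 (2.4)–(2.5).
* [Tankeev1996] S. G. Tankeev, Izv. Math. 60 (1996) 391–424.
* [GoodmanWallachGTM255] R. Goodman, N. Wallach, *Symmetry, Representations, and Invariants*, §4.1.1.
* [HoffmanKunze1971LinearAlgebra] K. Hoffman, R. Kunze, *Linear Algebra*, §6.7 (projections), §3.1 (rank–nullity).
-/

noncomputable section

open Module

namespace Literature.AlgebraicGeometry.Motives

namespace HodgeStructure

variable {W : Type*} [AddCommGroup W] [Module ℂ W]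

/-- **The Levi data at multiplicities `(2,4)`.** (Module docstring.) For `𝔊 ⊆ End(W)` bracket-closed, irreducible,
containing `1` and the involution `Θ` (`dim P = 2`, `dim Q = 4`): matrix units `E₁, E₂, U, V ∈ 𝔊` of the decomposition
`Q = range E₁ ⊕ range E₂` (both of rank `2`), the injective lowering `C` of the full-rank pair with `C(P) = range E₁`, the
level-one Levi irreducibility of `Q`, and the membership of the `E₂`-graded parts `E₁XE₂`, `E₂XE₁` of every `Θ`-commuting
`X ∈ 𝔊`. The Levi restriction algebra `𝔩 ⊆ End(Q)` used in the proof is the construction of `UnitaryTwoOdd.eq_top`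
(tree, `HodgeThetaSubalgebraUnitaryTwoOddCore`, copied with credit). [cite: Ribet1983, Thm. 3]
[cite: Gordon1997, §6 (proof of Thm. 6.3.3, pp. 18–19)] [cite: GoodmanWallachGTM255, §4.1.1] -/
theorem UnitaryFourTwo.exists_levi_data [FiniteDimensional ℂ W] {𝔊 : Submodule ℂ (Module.End ℂ W)}
    (hbr : ∀ Y ∈ 𝔊, ∀ Z ∈ 𝔊, Y * Z - Z * Y ∈ 𝔊) (h1 : (1 : Module.End ℂ W) ∈ 𝔊)
    (hirr : ∀ U : Submodule ℂ W, (∀ A ∈ 𝔊, ∀ u ∈ U, A u ∈ U) → U = ⊥ ∨ U = ⊤)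
    {Θ : Module.End ℂ W} (hΘ : Θ ∈ 𝔊) (hΘΘ : Θ * Θ = 1)
    {P Q : Submodule ℂ W} (hP : ∀ x, x ∈ P ↔ Θ x = x) (hQ : ∀ x, x ∈ Q ↔ Θ x = -x)
    (hP2 : finrank ℂ P = 2) (hQ4 : finrank ℂ Q = 4) :
    ∃ E₁ E₂ U V C : Module.End ℂ W,
      E₁ ∈ 𝔊 ∧ E₂ ∈ 𝔊 ∧ U ∈ 𝔊 ∧ V ∈ 𝔊 ∧ C ∈ 𝔊 ∧
      (E₁ + E₂ = (2 : ℂ)⁻¹ • (1 - Θ) ∧ E₁ * E₁ = E₁ ∧ E₂ * E₂ = E₂ ∧ E₁ * E₂ = 0 ∧ E₂ * E₁ = 0 ∧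
        E₂ * Θ = Θ * E₂ ∧ finrank ℂ (LinearMap.range E₁) = 2 ∧ finrank ℂ (LinearMap.range E₂) = 2) ∧
      (Θ * C = -C ∧ C * Θ = C ∧ (∀ p ∈ P, C p = 0 → p = 0) ∧ ∀ w, E₁ (C w) = C w) ∧
      (E₁ * U = U ∧ U * E₂ = U ∧ (∀ x, E₁ x = x → ∃ k, E₂ k = k ∧ U k = x) ∧
        ∀ k, E₂ k = k → U k = 0 → k = 0) ∧
      (E₂ * V = V ∧ V * E₁ = V ∧ (∀ k, E₂ k = k → ∃ x, E₁ x = x ∧ V x = k) ∧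
        ∀ x, E₁ x = x → V x = 0 → x = 0) ∧
      (∀ U' : Submodule ℂ W, U' ≤ Q → (∀ X ∈ 𝔊, X * Θ = Θ * X → ∀ y ∈ U', X y ∈ U') → U' = ⊥ ∨ U' = Q) ∧
      (∀ X ∈ 𝔊, X * Θ = Θ * X →
        E₁ * X * E₂ ∈ 𝔊 ∧ E₂ * X * E₁ ∈ 𝔊 ∧
          (X - E₁ * X * E₂ - E₂ * X * E₁) * E₂ = E₂ * (X - E₁ * X * E₂ - E₂ * X * E₁)) := by
  classical
  have hΘΘv : ∀ v, Θ (Θ v) = v := fun v => by rw [← Module.End.mul_apply, hΘΘ, Module.End.one_apply]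
  have hPhat : ∀ w, (2 : ℂ)⁻¹ • (w + Θ w) ∈ P := fun w => (hP _).2 (by rw [map_smul, map_add, hΘΘv, add_comm])
  have hQhat : ∀ w, (2 : ℂ)⁻¹ • (w - Θ w) ∈ Q := fun w =>
    (hQ _).2 (by rw [map_smul, map_sub, hΘΘv, ← smul_neg, neg_sub])
  have hsplit : ∀ w, (2 : ℂ)⁻¹ • (w + Θ w) + (2 : ℂ)⁻¹ • (w - Θ w) = w := fun w => by module
  have hc : IsCompl P Q := UnitaryFourTwo.isCompl_of_invol hΘΘ hP hQ
  have hQ2 : 2 ≤ finrank ℂ Q := by omega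
  -- the full-rank pair and the Cayley–Hamilton idempotent
  obtain ⟨B, hB, C, hC, hΘB, hBΘ, hΘC, hCΘ, hinj⟩ :=
    UnitaryThetaCore.exists_fullRank_pair_two hbr hirr hΘ hΘΘ hP hQ hP2 hQ2
  have hCinj : ∀ p ∈ P, C p = 0 → p = 0 := fun p hp h0 => hinj p hp (by rw [h0, map_zero])
  obtain ⟨E, hE, hEP, hEW, hEK, hECP, hEker, hfinmap, hsup, hinf⟩ :=
    UnitaryTwoOdd.exists_idempotent_of_fullRank_pair hbr hΘ hΘΘ hP hQ hB hC hΘB hBΘ hΘC hCΘ hinj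
  set K : Submodule ℂ W := Q ⊓ LinearMap.ker (C * B) with hKdef
  have hKQ : K ≤ Q := inf_le_left
  have hmapQ : P.map C ≤ Q := le_sup_right.trans hsup.le
  have hCmem : ∀ w, C w ∈ Q := fun w => (hQ _).2 (by rw [← Module.End.mul_apply, hΘC, LinearMap.neg_apply])
  have hCQ : ∀ q ∈ Q, C q = 0 := fun q hq => by
    have h : C q = -(C q) := by
      conv_lhs => rw [← neg_neg q, ← (hQ q).1 hq, map_neg, ← Module.End.mul_apply, hCΘ]
    have h2 : (2 : ℂ) • C q = 0 := by rw [two_smul]; nth_rewrite 2 [h]; rw [add_neg_cancel]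
    exact (smul_eq_zero.1 h2).resolve_left two_ne_zero
  have hCmemCP : ∀ w, C w ∈ P.map C := fun w => by
    have h : C w = C ((2 : ℂ)⁻¹ • (w + Θ w)) := by
      conv_lhs => rw [← hsplit w, map_add, hCQ _ (hQhat w), add_zero]
    rw [h]
    exact Submodule.mem_map_of_mem (hPhat w)
  have hEQ : ∀ w, E w ∈ Q := fun w => hKQ (hEW w)
  have hEE : ∀ w, E (E w) = E w := fun w => hEK _ (hEW w)
  have hEEm : E * E = E := LinearMap.ext fun w => by rw [Module.End.mul_apply, hEE]
  have hEΘ : E * Θ = Θ * E := by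
    refine LinearMap.ext fun w => ?_
    have hΘw : Θ w = (2 : ℂ)⁻¹ • (w + Θ w) - (2 : ℂ)⁻¹ • (w - Θ w) := by module
    rw [Module.End.mul_apply, Module.End.mul_apply, hΘw, map_sub, hEP _ (hPhat w), zero_sub, (hQ _).1 (hEQ w)]
    conv_rhs => rw [← hsplit w, map_add, hEP _ (hPhat w), zero_add]
  have hfinK : finrank ℂ K = 2 := by
    have h := Submodule.finrank_sup_add_finrank_inf_eq K (P.map C)
    rw [hsup, hinf, finrank_bot, add_zero, hfinmap, hP2, hQ4] at h
    omega
  have hfinCP : finrank ℂ (P.map C) = 2 := by rw [hfinmap, hP2]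
  -- the projector `π_Q` and the complementary idempotent `E₁ = π_Q − E`
  set πQ : Module.End ℂ W := (2 : ℂ)⁻¹ • ((1 : Module.End ℂ W) - Θ) with hπQdef
  have hπQ𝔊 : πQ ∈ 𝔊 := Submodule.smul_mem _ _ (Submodule.sub_mem _ h1 hΘ)
  have hπQapply : ∀ w, πQ w = (2 : ℂ)⁻¹ • (w - Θ w) := fun w => rfl
  have hπQq : ∀ q ∈ Q, πQ q = q := fun q hq => by
    rw [hπQapply, (hQ q).1 hq, sub_neg_eq_add, ← two_smul ℂ q, smul_smul, inv_mul_cancel₀ two_ne_zero, one_smul]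
  have hπQp : ∀ p ∈ P, πQ p = 0 := fun p hp => by rw [hπQapply, (hP p).1 hp, sub_self, smul_zero]
  have hπQmem : ∀ w, πQ w ∈ Q := fun w => hQhat w
  have hEπ : ∀ w, E (πQ w) = E w := fun w => by
    conv_rhs => rw [← hsplit w, map_add, hEP _ (hPhat w), zero_add]
    rw [hπQapply]
  set E₁ : Module.End ℂ W := πQ - E with hE₁def
  have hE₁𝔊 : E₁ ∈ 𝔊 := Submodule.sub_mem _ hπQ𝔊 hE
  have hE₁apply : ∀ w, E₁ w = πQ w - E w := fun w => rfl
  have hE₁P : ∀ p ∈ P, E₁ p = 0 := fun p hp => by rw [hE₁apply, hπQp p hp, hEP p hp, sub_zero]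
  have hE₁CP : ∀ w, E₁ w ∈ P.map C := fun w => by
    rw [hE₁apply, ← hEπ]
    exact hEker _ (Submodule.sub_mem _ (hπQmem w) (hEQ _)) (by rw [map_sub, hEE, sub_self])
  have hE₁id : ∀ x ∈ P.map C, E₁ x = x := by
    rintro _ ⟨p, hp, rfl⟩
    rw [hE₁apply, hπQq _ (hCmem p), hECP p hp, sub_zero]
  have hE₁Q : ∀ w, E₁ w ∈ Q := fun w => hmapQ (hE₁CP w)
  -- ranges
  have hrangeE : LinearMap.range E = K := by
    refine le_antisymm ?_ fun k hk => ⟨k, hEK k hk⟩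
    rintro _ ⟨w, rfl⟩; exact hEW w
  have hrangeE₁ : LinearMap.range E₁ = P.map C := by
    refine le_antisymm ?_ fun x hx => ⟨x, hE₁id x hx⟩
    rintro _ ⟨w, rfl⟩; exact hE₁CP w
  -- idempotent relations
  have hE₁E₁ : E₁ * E₁ = E₁ := LinearMap.ext fun w => by rw [Module.End.mul_apply, hE₁id _ (hE₁CP w)]
  have hE₁E : E₁ * E = 0 := LinearMap.ext fun w => by
    rw [Module.End.mul_apply, hE₁apply, hπQq _ (hEQ w), hEE, sub_self, LinearMap.zero_apply]
  have hEE₁ : E * E₁ = 0 := LinearMap.ext fun w => by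
    rw [Module.End.mul_apply, hE₁apply, map_sub, hEπ, hEE, sub_self, LinearMap.zero_apply]
  have hsum : E₁ + E = πQ := by rw [hE₁def, sub_add_cancel]
  -- membership characterisations of the two ranges
  have hmemK : ∀ k, E k = k ↔ k ∈ K := fun k =>
    ⟨fun h => by rw [← h]; exact hEW k, fun h => hEK k h⟩
  have hmemCP : ∀ x, E₁ x = x ↔ x ∈ P.map C := fun x =>
    ⟨fun h => by rw [← h]; exact hE₁CP x, fun h => hE₁id x h⟩
  -- the Levi restriction algebra `𝔩 ⊆ End(Q)` (construction of `UnitaryTwoOdd.eq_top`, tree)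
  set 𝔩 : Submodule ℂ (Module.End ℂ Q) :=
    { carrier := {A | ∃ Z ∈ 𝔊, Z * Θ = Θ * Z ∧ ∀ q : Q, ((A q : Q) : W) = Z q}
      zero_mem' := ⟨0, Submodule.zero_mem _, by rw [zero_mul, mul_zero], fun q => by simp⟩
      add_mem' := by
        rintro A A' ⟨Z, hZ, hZΘ, hAZ⟩ ⟨Z', hZ', hZ'Θ, hAZ'⟩
        exact ⟨Z + Z', Submodule.add_mem _ hZ hZ', by rw [add_mul, mul_add, hZΘ, hZ'Θ], fun q => by
          rw [LinearMap.add_apply, Submodule.coe_add, hAZ, hAZ', LinearMap.add_apply]⟩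
      smul_mem' := by
        rintro c A ⟨Z, hZ, hZΘ, hAZ⟩
        exact ⟨c • Z, Submodule.smul_mem _ c hZ, by rw [smul_mul_assoc, mul_smul_comm, hZΘ], fun q => by
          rw [LinearMap.smul_apply, Submodule.coe_smul, hAZ, LinearMap.smul_apply]⟩ } with h𝔩def
  have hmem𝔩 : ∀ A, A ∈ 𝔩 ↔ ∃ Z ∈ 𝔊, Z * Θ = Θ * Z ∧ ∀ q : Q, ((A q : Q) : W) = Z q := fun A => Iff.rfl
  have hcommQ : ∀ Z : Module.End ℂ W, Z * Θ = Θ * Z → ∀ q ∈ Q, Z q ∈ Q := fun Z hZ q hq =>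
    (hQ _).2 (by rw [← Module.End.mul_apply, ← hZ, Module.End.mul_apply, (hQ q).1 hq, map_neg])
  have hcommP : ∀ Z : Module.End ℂ W, Z * Θ = Θ * Z → ∀ p ∈ P, Z p ∈ P := fun Z hZ p hp =>
    (hP _).2 (by rw [← Module.End.mul_apply, ← hZ, Module.End.mul_apply, (hP p).1 hp])
  have hres : ∀ Z ∈ 𝔊, Z * Θ = Θ * Z → ∃ A ∈ 𝔩, ∀ q : Q, ((A q : Q) : W) = Z q := fun Z hZ hZΘ =>
    ⟨Z.restrict fun q hq => hcommQ Z hZΘ q hq, ⟨Z, hZ, hZΘ, fun q => rfl⟩, fun q => rfl⟩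
  have hbr𝔩 : ∀ A ∈ 𝔩, ∀ A' ∈ 𝔩, A * A' - A' * A ∈ 𝔩 := by
    intro A hA A' hA'
    obtain ⟨Z, hZ, hZΘ, hAZ⟩ := (hmem𝔩 A).1 hA
    obtain ⟨Z', hZ', hZ'Θ, hAZ'⟩ := (hmem𝔩 A').1 hA'
    refine (hmem𝔩 _).2 ⟨Z * Z' - Z' * Z, hbr Z hZ Z' hZ', ?_, fun q => ?_⟩
    · rw [sub_mul, mul_sub, mul_assoc, hZ'Θ, ← mul_assoc, hZΘ, mul_assoc, mul_assoc, hZΘ, ← mul_assoc Z', hZ'Θ,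
        mul_assoc]
    · rw [LinearMap.sub_apply, Submodule.coe_sub, Module.End.mul_apply, Module.End.mul_apply, hAZ, hAZ', hAZ',
        hAZ, LinearMap.sub_apply, Module.End.mul_apply, Module.End.mul_apply]
  have hirr𝔩 := UnitaryTwoOdd.levi_irreducible hbr hirr hΘ hΘΘ hP hQ 𝔩 hres
  -- the idempotent `f = E|_Q`, the involution `T = 1 − 2f` of `Q` and its eigenspaces
  set f : Module.End ℂ Q := E.restrict fun q (_ : q ∈ Q) => hEQ q with hfdef
  have hfapply : ∀ q : Q, ((f q : Q) : W) = E q := fun q => rfl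
  have hff : ∀ q : Q, f (f q) = f q := fun q => Subtype.ext (by rw [hfapply, hfapply, hEE])
  set T : Module.End ℂ Q := 1 - (f + f) with hTdef
  have hTapply : ∀ q : Q, ((T q : Q) : W) = (q : W) - (E q + E q) := fun q => by
    rw [hTdef, LinearMap.sub_apply, Module.End.one_apply, LinearMap.add_apply, Submodule.coe_sub,
      Submodule.coe_add, hfapply]
  have hT𝔩 : T ∈ 𝔩 := by
    refine (hmem𝔩 T).2 ⟨-Θ - (E + E), Submodule.sub_mem _ (Submodule.neg_mem _ hΘ) (Submodule.add_mem _ hE hE),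
      ?_, fun q => ?_⟩
    · rw [sub_mul, mul_sub, add_mul, mul_add, hEΘ, neg_mul, mul_neg]
    · rw [hTapply, LinearMap.sub_apply, LinearMap.neg_apply, LinearMap.add_apply, (hQ _).1 q.2, neg_neg]
  have hTT : T * T = 1 := LinearMap.ext fun q => Subtype.ext (by
    rw [Module.End.mul_apply, Module.End.one_apply, hTapply, hTapply, map_sub, map_add, hEE]
    abel)
  set P' : Submodule ℂ Q := LinearMap.ker f with hP'def
  set Q' : Submodule ℂ Q := LinearMap.range f with hQ'def
  have hP' : ∀ x, x ∈ P' ↔ T x = x := fun x => by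
    rw [hP'def, LinearMap.mem_ker]
    constructor
    · intro h
      apply Subtype.ext
      rw [hTapply, ← hfapply, h, Submodule.coe_zero, add_zero, sub_zero]
    · intro h
      have h' := congrArg Subtype.val h
      rw [hTapply, sub_eq_self, ← two_smul ℂ, smul_eq_zero] at h'
      exact Subtype.ext (by rw [hfapply]; exact h'.resolve_left two_ne_zero)
  have hQ'mem : ∀ x : Q, x ∈ Q' ↔ E x = x := fun x => by
    rw [hQ'def, LinearMap.mem_range]
    constructor
    · rintro ⟨y, rfl⟩
      rw [hfapply, hEE]
    · intro h
      exact ⟨x, Subtype.ext (by rw [hfapply, h])⟩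
  have hQ' : ∀ x, x ∈ Q' ↔ T x = -x := fun x => by
    rw [hQ'mem]
    constructor
    · intro h
      apply Subtype.ext
      rw [hTapply, h, Submodule.coe_neg]
      abel
    · intro h
      have h' := congrArg Subtype.val h
      rw [hTapply, Submodule.coe_neg] at h'
      have h3 := eq_neg_iff_add_eq_zero.1 h'
      have h2 : E x + E x = (x : W) + x := by
        rw [← sub_eq_zero, ← neg_eq_zero, ← h3]; abel
      rw [← two_smul ℂ (E (x : W)), ← two_smul ℂ (x : W)] at h2
      exact smul_right_injective W (two_ne_zero' ℂ) h2
  have hP'W : ∀ x : Q, x ∈ P' ↔ (x : W) ∈ P.map C := fun x => by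
    rw [hP'def, LinearMap.mem_ker]
    constructor
    · intro h
      exact hEker x x.2 (by rw [← hfapply, h, Submodule.coe_zero])
    · rintro ⟨p, hp, hpx⟩
      apply Subtype.ext
      rw [hfapply, Submodule.coe_zero, ← hpx, hECP p hp]
  have hQ'W : ∀ x : Q, x ∈ Q' ↔ (x : W) ∈ K := fun x => by
    rw [hQ'mem, hmemK]
  have hP'eq : P' = Submodule.comap Q.subtype (P.map C) := by
    ext x; rw [hP'W, Submodule.mem_comap, Submodule.subtype_apply]
  have hQ'eq : Q' = Submodule.comap Q.subtype K := by
    ext x; rw [hQ'W, Submodule.mem_comap, Submodule.subtype_apply]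
  have hfinP' : finrank ℂ P' = 2 := by
    rw [hP'eq, (Submodule.comapSubtypeEquivOfLe hmapQ).finrank_eq, hfinCP]
  have hfinQ' : finrank ℂ Q' = 2 := by
    rw [hQ'eq, (Submodule.comapSubtypeEquivOfLe hKQ).finrank_eq, hfinK]
  -- raising operators of `𝔩` ONTO the two eigenspaces (`UnitaryTwoOdd.exists_raise_onto`, for `T` and for `−T`)
  obtain ⟨u, hu𝔩, hTu, huT, huonto⟩ :=
    UnitaryTwoOdd.exists_raise_onto hbr𝔩 hirr𝔩 hT𝔩 hTT hP' hQ' hfinP' (by rw [hfinQ'])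
  have hnT𝔩 : -T ∈ 𝔩 := Submodule.neg_mem _ hT𝔩
  have hnTT : (-T) * (-T) = 1 := (neg_mul_neg T T).trans hTT
  have hQ'n : ∀ x, x ∈ Q' ↔ (-T) x = x := fun x => by rw [hQ', LinearMap.neg_apply, neg_eq_iff_eq_neg]
  have hP'n : ∀ x, x ∈ P' ↔ (-T) x = -x := fun x => by rw [hP', LinearMap.neg_apply, neg_inj]
  obtain ⟨v, hv𝔩, hTv, hvT, hvonto⟩ :=
    UnitaryTwoOdd.exists_raise_onto hbr𝔩 hirr𝔩 hnT𝔩 hnTT hQ'n hP'n hfinQ' (by rw [hfinP'])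
  -- `u` kills `P'`, maps into `P'`, and `u ∘ f = u`; `v` kills `Q'`, maps into `Q'`, `f ∘ v = v`, `v ∘ f = 0`
  have huP' : ∀ x ∈ P', u x = 0 := UnitaryFourTwo.apply_eq_zero_of_mul_theta huT hP'
  have humem : ∀ x, u x ∈ P' := fun x => (hP' _).2 (by rw [← Module.End.mul_apply, hTu])
  have hvQ' : ∀ x ∈ Q', v x = 0 := UnitaryFourTwo.apply_eq_zero_of_mul_theta hvT hQ'n
  have hvmem : ∀ x, v x ∈ Q' := fun x => (hQ'n _).2 (by rw [← Module.End.mul_apply, hTv])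
  have huf : ∀ x : Q, u (f x) = u x := fun x => by
    have hx : x - f x ∈ P' := by rw [hP'def, LinearMap.mem_ker, map_sub, hff, sub_self]
    have h := huP' _ hx
    rw [map_sub, sub_eq_zero] at h
    exact h.symm
  have hfu : ∀ x : Q, f (u x) = 0 := fun x => by
    have h := humem x; rw [hP'def, LinearMap.mem_ker] at h; exact h
  have hfv : ∀ x : Q, f (v x) = v x := fun x => Subtype.ext (by rw [hfapply]; exact (hQ'mem _).1 (hvmem x))
  have hvf : ∀ x : Q, v (f x) = 0 := fun x => hvQ' _ (by rw [hQ'def]; exact ⟨x, rfl⟩)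
  -- lifts to `W`: `U = ZE − EZ`, `V = EZ' − Z'E`
  obtain ⟨Z, hZ, hZΘ, huZ⟩ := (hmem𝔩 u).1 hu𝔩
  obtain ⟨Z', hZ', hZ'Θ, hvZ'⟩ := (hmem𝔩 v).1 hv𝔩
  set U : Module.End ℂ W := Z * E - E * Z with hUdef
  set V : Module.End ℂ W := E * Z' - Z' * E with hVdef
  have hU𝔊 : U ∈ 𝔊 := hbr Z hZ E hE
  have hV𝔊 : V ∈ 𝔊 := hbr E hE Z' hZ'
  have hUq : ∀ q : Q, U q = u q := fun q => by
    have h1 : Z (E q) = ((u (f q) : Q) : W) := (huZ (f q)).symm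
    have h2 : E (Z q) = ((f (u q) : Q) : W) := by rw [hfapply, huZ]
    rw [hUdef, LinearMap.sub_apply, Module.End.mul_apply, Module.End.mul_apply, h1, h2, huf, hfu,
      Submodule.coe_zero, sub_zero]
  have hVq : ∀ q : Q, V q = v q := fun q => by
    have h1 : E (Z' q) = ((f (v q) : Q) : W) := by rw [hfapply, hvZ']
    have h2 : Z' (E q) = ((v (f q) : Q) : W) := (hvZ' (f q)).symm
    rw [hVdef, LinearMap.sub_apply, Module.End.mul_apply, Module.End.mul_apply, h1, h2, hfv, hvf,
      Submodule.coe_zero, sub_zero]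
  have hUP : ∀ p ∈ P, U p = 0 := fun p hp => by
    rw [hUdef, LinearMap.sub_apply, Module.End.mul_apply, Module.End.mul_apply, hEP p hp, map_zero,
      hEP _ (hcommP Z hZΘ p hp), sub_zero]
  have hVP : ∀ p ∈ P, V p = 0 := fun p hp => by
    rw [hVdef, LinearMap.sub_apply, Module.End.mul_apply, Module.End.mul_apply, hEP p hp, map_zero,
      hEP _ (hcommP Z' hZ'Θ p hp), zero_sub, neg_zero]
  have hUw : ∀ w, U w = U (πQ w) := fun w => by
    conv_lhs => rw [← hsplit w, map_add, hUP _ (hPhat w), zero_add]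
    rw [hπQapply]
  have hVw : ∀ w, V w = V (πQ w) := fun w => by
    conv_lhs => rw [← hsplit w, map_add, hVP _ (hPhat w), zero_add]
    rw [hπQapply]
  have hUmem : ∀ w, U w ∈ P.map C := fun w => by
    rw [hUw, hUq ⟨πQ w, hπQmem w⟩]
    exact (hP'W _).1 (humem _)
  have hVmemK : ∀ w, V w ∈ K := fun w => by
    rw [hVw, hVq ⟨πQ w, hπQmem w⟩]
    exact (hQ'W _).1 (hvmem _)
  -- `E₁ U = U`, `U E = U`; `E V = V`, `V E₁ = V`
  have hE₁U : E₁ * U = U := LinearMap.ext fun w => by rw [Module.End.mul_apply, hE₁id _ (hUmem w)]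
  have hUE : U * E = U := by
    refine UnitaryFourTwo.end_ext hΘΘ hP hQ (fun p hp => ?_) (fun q hq => ?_)
    · rw [Module.End.mul_apply, hEP p hp, map_zero, hUP p hp]
    · have hq' : U q = ((u ⟨q, hq⟩ : Q) : W) := hUq ⟨q, hq⟩
      have hEq' : U (E q) = ((u ⟨E q, hEQ q⟩ : Q) : W) := hUq ⟨E q, hEQ q⟩
      have hfq : (⟨E q, hEQ q⟩ : Q) = f ⟨q, hq⟩ := Subtype.ext (by rw [hfapply])
      rw [Module.End.mul_apply, hEq', hq', hfq, huf]
  have hEV : E * V = V := LinearMap.ext fun w => by rw [Module.End.mul_apply, hEK _ (hVmemK w)]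
  have hVE0 : ∀ w, V (E w) = 0 := fun w => by
    have h : V (E w) = ((v ⟨E w, hEQ w⟩ : Q) : W) := hVq ⟨E w, hEQ w⟩
    have hfq : (⟨E w, hEQ w⟩ : Q) = f ⟨πQ w, hπQmem w⟩ := Subtype.ext (by rw [hfapply, hEπ])
    rw [h, hfq, hvf, Submodule.coe_zero]
  have hVE₁ : V * E₁ = V := by
    refine LinearMap.ext fun w => ?_
    rw [Module.End.mul_apply, hE₁apply, map_sub, ← hVw, hVE0, sub_zero]
  -- `U` maps `K` onto `C(P)`, `V` maps `C(P)` onto `K`; injectivity by dimension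
  have hUonto : ∀ x, E₁ x = x → ∃ k, E k = k ∧ U k = x := by
    intro x hx
    have hxCP : x ∈ P.map C := (hmemCP x).1 hx
    obtain ⟨w, hw⟩ := huonto ⟨x, hmapQ hxCP⟩ ((hP'W _).2 hxCP)
    refine ⟨E w, hEE w, ?_⟩
    have h := hUq (f w)
    rw [huf, hw] at h
    exact h
  have hVonto : ∀ k, E k = k → ∃ x, E₁ x = x ∧ V x = k := by
    intro k hk
    have hkK : k ∈ K := (hmemK k).1 hk
    obtain ⟨w, hw⟩ := hvonto ⟨k, hKQ hkK⟩ ((hQ'W _).2 hkK)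
    refine ⟨E₁ w, hE₁id _ (hE₁CP w), ?_⟩
    have hw' : (w : W) - E w ∈ Q := Submodule.sub_mem _ w.2 (hEQ _)
    have h := hVq ⟨(w : W) - E w, hw'⟩
    have heq : (⟨(w : W) - E w, hw'⟩ : Q) = w - f w := Subtype.ext (by rw [Submodule.coe_sub, hfapply])
    rw [heq, map_sub, hvf, sub_zero, hw] at h
    rw [hE₁apply, hπQq _ w.2]
    exact h
  have hUinj : ∀ k, E k = k → U k = 0 → k = 0 := by
    let g : K →ₗ[ℂ] P.map C := LinearMap.codRestrict (P.map C) (U ∘ₗ K.subtype) fun k => hUmem k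
    have hgsurj : Function.Surjective g := fun x => by
      obtain ⟨k, hk, hkx⟩ := hUonto x ((hmemCP x).2 x.2)
      exact ⟨⟨k, (hmemK k).1 hk⟩, Subtype.ext hkx⟩
    have hginj : Function.Injective g :=
      (LinearMap.injective_iff_surjective_of_finrank_eq_finrank (by rw [hfinK, hfinCP])).2 hgsurj
    intro k hk hUk
    have h : g ⟨k, (hmemK k).1 hk⟩ = 0 := Subtype.ext hUk
    exact congrArg Subtype.val (hginj (h.trans (map_zero g).symm))
  have hVinj : ∀ x, E₁ x = x → V x = 0 → x = 0 := by
    let g : P.map C →ₗ[ℂ] K := LinearMap.codRestrict K (V ∘ₗ (P.map C).subtype) fun x => hVmemK x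
    have hgsurj : Function.Surjective g := fun k => by
      obtain ⟨x, hx, hxk⟩ := hVonto k ((hmemK k).2 k.2)
      exact ⟨⟨x, (hmemCP x).1 hx⟩, Subtype.ext hxk⟩
    have hginj : Function.Injective g :=
      (LinearMap.injective_iff_surjective_of_finrank_eq_finrank (by rw [hfinK, hfinCP])).2 hgsurj
    intro x hx hVx
    have h : g ⟨x, (hmemCP x).1 hx⟩ = 0 := Subtype.ext hVx
    exact congrArg Subtype.val (hginj (h.trans (map_zero g).symm))
  -- level-one Levi irreducibility, transported to `W`
  have hleviW : ∀ U' : Submodule ℂ W, U' ≤ Q → (∀ X ∈ 𝔊, X * Θ = Θ * X → ∀ y ∈ U', X y ∈ U') →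
      U' = ⊥ ∨ U' = Q := by
    intro U' hU'Q hU'
    have h := hirr𝔩 (U'.comap Q.subtype) fun A hA y hy => by
      obtain ⟨X, hX, hXΘ, hAX⟩ := (hmem𝔩 A).1 hA
      rw [Submodule.mem_comap, Submodule.subtype_apply, hAX]
      exact hU' X hX hXΘ _ hy
    have hmap : U' = (U'.comap Q.subtype).map Q.subtype := by
      rw [Submodule.map_comap_subtype, inf_eq_right.2 hU'Q]
    rcases h with h | h
    · left; rw [hmap, h, Submodule.map_bot]
    · right; rw [hmap, h, Submodule.map_subtype_top]
  -- graded parts of a `Θ`-commuting `X ∈ 𝔊`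
  have hgraded : ∀ X ∈ 𝔊, X * Θ = Θ * X →
      E₁ * X * E ∈ 𝔊 ∧ E * X * E₁ ∈ 𝔊 ∧ (X - E₁ * X * E - E * X * E₁) * E = E * (X - E₁ * X * E - E * X * E₁) := by
    intro X hX hXΘ
    have hXπ : X * πQ = πQ * X := by
      rw [hπQdef, mul_smul_comm, smul_mul_assoc, mul_sub, sub_mul, mul_one, one_mul, hXΘ]
    have hπE : πQ * E = E := LinearMap.ext fun w => by rw [Module.End.mul_apply, hπQq _ (hEQ w)]
    have hEπm : E * πQ = E := LinearMap.ext fun w => by rw [Module.End.mul_apply, hEπ]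
    set D₁ : Module.End ℂ W := E * X - X * E with hD₁def
    have hD₁ : D₁ ∈ 𝔊 := hbr E hE X hX
    have hD₂ : E * D₁ - D₁ * E ∈ 𝔊 := hbr E hE D₁ hD₁
    have h12 : E₁ * X * E = X * E - E * X * E := by
      rw [hE₁def, sub_mul, sub_mul, ← hXπ, mul_assoc X πQ E, hπE]
    have h21 : E * X * E₁ = E * X - E * X * E := by
      rw [hE₁def, mul_sub, mul_assoc E X πQ, hXπ, ← mul_assoc E πQ X, hEπm]
    have hdiff : E * D₁ - D₁ * E - D₁ = (2 : ℂ) • (X * E - E * X * E) := by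
      refine LinearMap.ext fun w => ?_
      simp only [hD₁def, LinearMap.sub_apply, Module.End.mul_apply, map_sub, hEE, LinearMap.smul_apply]
      module
    have hsum' : E * D₁ - D₁ * E + D₁ = (2 : ℂ) • (E * X - E * X * E) := by
      refine LinearMap.ext fun w => ?_
      simp only [hD₁def, LinearMap.sub_apply, LinearMap.add_apply, Module.End.mul_apply, map_sub, hEE,
        LinearMap.smul_apply]
      module
    refine ⟨?_, ?_, ?_⟩
    · rw [h12]
      have h := Submodule.smul_mem 𝔊 (2 : ℂ)⁻¹ (Submodule.sub_mem _ hD₂ hD₁)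
      rwa [hdiff, smul_smul, inv_mul_cancel₀ two_ne_zero, one_smul] at h
    · rw [h21]
      have h := Submodule.smul_mem 𝔊 (2 : ℂ)⁻¹ (Submodule.add_mem _ hD₂ hD₁)
      rwa [hsum', smul_smul, inv_mul_cancel₀ two_ne_zero, one_smul] at h
    · rw [h12, h21]
      refine LinearMap.ext fun w => ?_
      simp only [LinearMap.sub_apply, Module.End.mul_apply, map_sub, hEE]
      abel
  refine ⟨E₁, E, U, V, C, hE₁𝔊, hE, hU𝔊, hV𝔊, hC, ⟨hsum, hE₁E₁, hEEm, hE₁E, hEE₁, hEΘ, by rw [hrangeE₁, hfinCP],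
    by rw [hrangeE, hfinK]⟩, ⟨hΘC, hCΘ, hCinj, fun w => hE₁id _ (hCmemCP w)⟩, ⟨hE₁U, hUE, hUonto, hUinj⟩,
    ⟨hEV, hVE₁, hVonto, hVinj⟩, hleviW, hgraded⟩

end HodgeStructure

end Literature.AlgebraicGeometry.Motives

end
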